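import Summits.Langlands.Langlands.Theorems.MonodromyRankLadderJSemicontinuity
import HarnessLib

/-!
# `MonodromyRankLadder.GenericIffRankMaximal` (stmt-Langlands-27783), part II:
under rank-maximality, strings reach the top of an occupied interval

Setting as in part I.  `t` is *rank-maximal* if `rank (t' ^ k) ≤ rank (t ^ k)` for every
degree `+1` endomorphism `t'` and every `k ≥ 1`.
* `exists_comp_pow_ne_zero_of_rankMax` — if `t` is rank-maximal and the simple type `S` occurs in
  every degree `p, …, q`, then some copy `e : S → gr p` has `t ^ (q - p) e ≠ 0`.  Otherwise choose
  copies `e_j : S → gr j` (`p ≤ j ≤ q`) and the degree `+1` map `u` shifting `e_j` to `e_{j+1}`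
  (zero on a complement); compare `rank ((t + s u) ^ c)`, `c = q - p`, with `rank (t ^ c)` piece by
  piece — on `⨁_{i ≠ p} gr i` and on an `S`-free complement `B` of the `S`-isotypic part of `gr p`
  it does not drop for almost all `s` (part I), on `e_p (S)` it is `≥ 1` for almost all `s`
  (`u ^ c e_p = e_q ≠ 0`), and the image of `e_p (S)` (simple) meets the image of `B` (no
  constituent `S`) trivially; while `t ^ c` kills the `S`-isotypic part of `gr p`.  So
  `rank ((t + s u) ^ c) > rank (t ^ c)` for some `s`, contradicting rank-maximality.
lens-2 g26 node twin (decomp-langlands), 2026-08-31.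
-/

set_option linter.dupNamespace false

namespace Summit.Langlands.Langlands.Theorems

namespace RankLadderJ

open Module

section Helpers

variable {K : Type*} [Field K] {R : Type*} [Ring R] [Algebra K R]
  {M : Type*} [AddCommGroup M] [Module K M] [Module R M] [IsScalarTower K R M]

/-- `K`-dimension of an `R`-submodule after restriction of scalars. -/
theorem finrank_restrictScalars_R (P : Submodule R M) :
    finrank K (P.restrictScalars K) = finrank K P :=
  ((P.restrictScalarsEquiv K).restrictScalars K).finrank_eq

/-- The zero `R`-submodule has `K`-dimension `0`. -/
theorem finrank_bot_R : finrank K (⊥ : Submodule R M) = 0 := by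
  rw [← finrank_restrictScalars_R, Submodule.restrictScalars_bot, finrank_bot]

/-- `K`-dimension is monotone on `R`-submodules. -/
theorem finrank_le_of_le_R [FiniteDimensional K M] {P Q : Submodule R M} (h : P ≤ Q) :
    finrank K P ≤ finrank K Q := by
  rw [← finrank_restrictScalars_R P, ← finrank_restrictScalars_R Q]
  exact Submodule.finrank_mono ((Submodule.restrictScalars_le (S := K)).mpr h)

/-- `K`-dimension of a sup of two `R`-submodules is subadditive. -/
theorem finrank_sup_le_R [FiniteDimensional K M] (P Q : Submodule R M) :
    finrank K ↥(P ⊔ Q) ≤ finrank K P + finrank K Q := by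
  rw [← finrank_restrictScalars_R (P ⊔ Q), ← finrank_restrictScalars_R P,
    ← finrank_restrictScalars_R Q, Submodule.restrictScalars_sup]
  exact Submodule.finrank_add_le_finrank_add_finrank _ _

/-- `K`-dimension is additive on disjoint `R`-submodules. -/
theorem finrank_sup_eq_of_disjoint_R [FiniteDimensional K M] {P Q : Submodule R M}
    (h : Disjoint P Q) : finrank K ↥(P ⊔ Q) = finrank K P + finrank K Q := by
  rw [← finrank_restrictScalars_R (P ⊔ Q), ← finrank_restrictScalars_R P,
    ← finrank_restrictScalars_R Q, Submodule.restrictScalars_sup]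
  have h' : Disjoint (P.restrictScalars K) (Q.restrictScalars K) :=
    (Submodule.disjoint_restrictScalars_iff (S := K)).mpr h
  have := Submodule.finrank_sup_add_finrank_inf_eq (P.restrictScalars K) (Q.restrictScalars K)
  rw [h'.eq_bot, finrank_bot, add_zero] at this
  exact this

/-- Scaling a linear map by a non-zero scalar does not change images. -/
theorem map_smul_of_ne_zero (T : M →ₗ[R] M) {a : K} (ha : a ≠ 0) (N : Submodule R M) :
    N.map (a • T) = N.map T := by
  ext y
  constructor
  · rintro ⟨x, hx, rfl⟩
    exact ⟨a • x, N.smul_of_tower_mem a hx, by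
      rw [LinearMap.smul_apply, LinearMap.map_smul_of_tower]⟩
  · rintro ⟨x, hx, rfl⟩
    refine ⟨a⁻¹ • x, N.smul_of_tower_mem _ hx, ?_⟩
    rw [LinearMap.smul_apply, LinearMap.map_smul_of_tower, smul_smul, mul_inv_cancel₀ ha, one_smul]

/-- **Retractions in semisimple modules.**  An injective `e : S → M` whose image meets `G`
trivially has a retraction killing `G`. -/
theorem exists_retraction [IsSemisimpleModule R M] {S : Type*} [AddCommGroup S] [Module R S]
    (e : S →ₗ[R] M) (he : Function.Injective e) (G : Submodule R M)
    (hdisj : Disjoint (LinearMap.range e) G) :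
    ∃ π : M →ₗ[R] S, (∀ s, π (e s) = s) ∧ ∀ x ∈ G, π x = 0 := by
  have hinj : Function.Injective (e.coprod G.subtype) := by
    rw [← LinearMap.ker_eq_bot, LinearMap.ker_coprod_of_disjoint_range, LinearMap.ker_eq_bot.mpr he,
      Submodule.ker_subtype, Submodule.prod_bot]
    rwa [Submodule.range_subtype]
  obtain ⟨π, hπ⟩ := IsSemisimpleModule.extension_property _ hinj (LinearMap.fst R S G)
  refine ⟨π, fun s => ?_, fun x hx => ?_⟩
  · have := congr($hπ (s, 0))
    simpa using this
  · have := congr($hπ (0, ⟨x, hx⟩))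
    simpa using this

/-- **Quotients of `S`-free semisimple modules are `S`-free.**  If no non-zero map `S → M` takes
values in the submodule `B`, then none takes values in `T(B)`. -/
theorem eq_zero_of_forall_mem_map [IsSemisimpleModule R M] {S : Type*} [AddCommGroup S]
    [Module R S] (B : Submodule R M) (hB : ∀ e : S →ₗ[R] M, (∀ s, e s ∈ B) → e = 0)
    (T : M →ₗ[R] M) (e : S →ₗ[R] M) (he : ∀ s, e s ∈ B.map T) : e = 0 := by
  set TB : B →ₗ[R] M := T ∘ₗ B.subtype with hTB
  have hrange : LinearMap.range TB = B.map T := by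
    rw [hTB, LinearMap.range_comp, Submodule.range_subtype]
  have he' : ∀ s, e s ∈ LinearMap.range TB := fun s => hrange ▸ he s
  obtain ⟨h, hh⟩ := IsSemisimpleModule.lifting_property TB.rangeRestrict
    (LinearMap.surjective_rangeRestrict TB) (e.codRestrict _ he')
  have h0 : B.subtype ∘ₗ h = 0 := hB _ fun s => (h s).2
  have h0' : h = 0 := by
    ext s
    exact congr($h0 s)
  ext s
  have := congr($hh s)
  rw [h0', LinearMap.comp_zero, LinearMap.zero_apply] at this
  have := congrArg Subtype.val this
  simpa using this.symm

end Helpers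

section RankMax

variable {K : Type*} [Field K] {R : Type*} [Ring R] [Algebra K R]
  {M : Type*} [AddCommGroup M] [Module K M] [Module R M] [IsScalarTower K R M]

/-- **Under rank-maximality, strings reach the top of an occupied interval.**  Let `M` be a graded
finite-dimensional semisimple `R`-module over an infinite field `K`, `t` a degree `+1`
endomorphism which is rank-maximal (`rank (t' ^ k) ≤ rank (t ^ k)` for all degree `+1` `t'` and
`k ≥ 1`).  If the simple type `S` occurs in every degree `p, …, q` then some `e : S → gr p` has
`t ^ (q - p) e ≠ 0`. [folklore] -/
theorem exists_comp_pow_ne_zero_of_rankMax [FiniteDimensional K M] [IsSemisimpleModule R M]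
    [Infinite K] (gr : ℕ → Submodule R M) (hind : iSupIndep gr) (hsup : ⨆ k, gr k = ⊤)
    (t : M →ₗ[R] M) (ht : ∀ k, ∀ x ∈ gr k, t x ∈ gr (k + 1))
    (hmax : ∀ t' : M →ₗ[R] M, (∀ k, ∀ x ∈ gr k, t' x ∈ gr (k + 1)) →
      ∀ k, 1 ≤ k → finrank K (LinearMap.range (t' ^ k)) ≤ finrank K (LinearMap.range (t ^ k)))
    {S : Type*} [AddCommGroup S] [Module R S] [IsSimpleModule R S] (p q : ℕ) (hpq : p ≤ q)
    (hocc : ∀ k, p ≤ k → k ≤ q → ∃ u : S →ₗ[R] M, u ≠ 0 ∧ ∀ s, u s ∈ gr k) :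
    ∃ e : S →ₗ[R] M, (∀ s, e s ∈ gr p) ∧ (t ^ (q - p)) ∘ₗ e ≠ 0 := by
  classical
  rcases Nat.eq_or_lt_of_le hpq with hpq' | hpq'
  · subst hpq'
    obtain ⟨u, hu, hu'⟩ := hocc p le_rfl le_rfl
    exact ⟨u, hu', by rwa [Nat.sub_self, pow_zero, Module.End.one_eq_id, LinearMap.id_comp]⟩
  set c := q - p with hc
  have hc1 : 1 ≤ c := by omega
  by_contra hcon
  push Not at hcon
  -- copies `e j : S → gr j`, non-zero for `p ≤ j ≤ q`
  have hocc' : ∀ j, ∃ u : S →ₗ[R] M, (∀ s, u s ∈ gr j) ∧ (p ≤ j ∧ j ≤ q → u ≠ 0) := by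
    intro j
    by_cases hj : p ≤ j ∧ j ≤ q
    · obtain ⟨u, hu, hu'⟩ := hocc j hj.1 hj.2
      exact ⟨u, hu', fun _ => hu⟩
    · exact ⟨0, fun s => zero_mem _, fun h => absurd h hj⟩
  choose e he hne using hocc'
  have heinj : ∀ j, p ≤ j → j ≤ q → Function.Injective (e j) := fun j hj1 hj2 =>
    (LinearMap.injective_or_eq_zero (e j)).resolve_right (hne j ⟨hj1, hj2⟩)
  -- membership in `⨆_{i ≠ j} gr i`
  have hmem_ne : ∀ {j i : ℕ} (_ : i ≠ j) {x : M}, x ∈ gr i → x ∈ ⨆ (i) (_ : i ≠ j), gr i :=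
    fun {j i} hij {x} hx => Submodule.mem_iSup_of_mem i (Submodule.mem_iSup_of_mem hij hx)
  -- retractions `π j` of `e j` killing the other degrees
  have hret : ∀ j, ∃ π : M →ₗ[R] S, (∀ i, i ≠ j → ∀ x ∈ gr i, π x = 0) ∧
      (p ≤ j ∧ j ≤ q → ∀ s, π (e j s) = s) := by
    intro j
    by_cases hj : p ≤ j ∧ j ≤ q
    · have hdisj : Disjoint (LinearMap.range (e j)) (⨆ (i) (_ : i ≠ j), gr i) := by
        refine (hind j).mono_left ?_
        rintro _ ⟨s, rfl⟩
        exact he j s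
      obtain ⟨π, hπ1, hπ2⟩ := exists_retraction (e j) (heinj j hj.1 hj.2) _ hdisj
      exact ⟨π, fun i hij x hx => hπ2 x (hmem_ne hij hx), fun _ => hπ1⟩
    · exact ⟨0, fun _ _ _ _ => rfl, fun h => absurd h hj⟩
  choose π hπ0 hπe using hret
  -- the shift `u`
  set u : M →ₗ[R] M := ∑ j ∈ Finset.range q, e (j + 1) ∘ₗ π j with hudef
  have hu_apply : ∀ x, u x = ∑ j ∈ Finset.range q, e (j + 1) (π j x) := fun x => by
    rw [hudef, LinearMap.sum_apply]
    simp only [LinearMap.comp_apply]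
  have hu_deg : ∀ i, ∀ x ∈ gr i, u x ∈ gr (i + 1) := by
    intro i x hx
    rw [hu_apply]
    refine Submodule.sum_mem _ fun j _ => ?_
    by_cases hji : j = i
    · subst hji; exact he _ _
    · rw [hπ0 j i (Ne.symm hji) x hx, map_zero]; exact zero_mem _
  have hu_e : ∀ j, p ≤ j → j < q → ∀ s, u (e j s) = e (j + 1) s := by
    intro j hj1 hj2 s
    rw [hu_apply, Finset.sum_eq_single j]
    · rw [hπe j ⟨hj1, hj2.le⟩]
    · intro j' _ hj'
      rw [hπ0 j' j (Ne.symm hj') _ (he j s), map_zero]  -- careful: hj' : j' ≠ j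
    · intro hj; exact absurd (Finset.mem_range.mpr hj2) hj
  have hu_pow : ∀ n, n ≤ c → ∀ s, (u ^ n) (e p s) = e (p + n) s := by
    intro n
    induction n with
    | zero => intro _ s; simp
    | succ n ih =>
      intro hn s
      rw [pow_succ', Module.End.mul_apply, ih (by omega), hu_e (p + n) (by omega) (by omega)]
      rfl
  have huc : (u ^ c) ∘ₗ e p = e q := by
    ext s
    rw [LinearMap.comp_apply, hu_pow c le_rfl, show p + c = q by omega]
  have huc_ne : (u ^ c) ∘ₗ e p ≠ 0 := by rw [huc]; exact hne q ⟨hpq, le_rfl⟩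
  -- the deformation `t + s u` has degree `+1`
  have hTdeg : ∀ (s : K) k, ∀ x ∈ gr k, (t + s • u) x ∈ gr (k + 1) := fun s k x hx => by
    rw [LinearMap.add_apply, LinearMap.smul_apply]
    exact add_mem (ht k x hx) (Submodule.smul_of_tower_mem _ s (hu_deg k x hx))
  -- the pieces: `G' = ⨁_{i ≠ p} gr i`, the `S`-isotypic part `A` of `gr p`, an `S`-free
  -- complement `B` of `A` in `gr p`, and `E = e p (S)`
  set G' : Submodule R M := ⨆ (i) (_ : i ≠ p), gr i with hG'
  set A : Submodule R M := ⨆ e' : {e' : S →ₗ[R] M // ∀ s, e' s ∈ gr p}, LinearMap.range e'.1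
    with hA
  have hAle : A ≤ gr p := by
    refine iSup_le fun e' => ?_
    rintro _ ⟨s, rfl⟩
    exact e'.2 s
  have hAkill : ∀ x ∈ A, (t ^ c) x = 0 := by
    intro x hx
    refine Submodule.iSup_induction _ (motive := fun x => (t ^ c) x = 0) hx ?_ (map_zero _) ?_
    · rintro e' _ ⟨s, rfl⟩
      exact congr($(hcon e'.1 e'.2) s)
    · intro x y hx hy
      rw [map_add, hx, hy, add_zero]
  obtain ⟨Y, hY⟩ := exists_isCompl A
  set B : Submodule R M := Y ⊓ gr p with hB
  have hBle : B ≤ gr p := inf_le_right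
  have hgrp : gr p = A ⊔ B := by
    refine le_antisymm ?_ (sup_le hAle hBle)
    intro x hx
    obtain ⟨a, ha, y, hy, rfl⟩ := Submodule.mem_sup.mp
      ((hY.sup_eq_top.symm ▸ Submodule.mem_top : x ∈ A ⊔ Y))
    refine Submodule.mem_sup.mpr ⟨a, ha, y, ⟨hy, ?_⟩, rfl⟩
    have : a + y - a ∈ gr p := sub_mem hx (hAle ha)
    rwa [add_sub_cancel_left] at this
  have hBfree : ∀ e' : S →ₗ[R] M, (∀ s, e' s ∈ B) → e' = 0 := by
    intro e' he'
    have h1 : LinearMap.range e' ≤ A :=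
      le_iSup_of_le ⟨e', fun s => hBle (he' s)⟩ le_rfl
    have h2 : LinearMap.range e' ≤ Y := by
      rintro _ ⟨s, rfl⟩; exact (he' s).1
    ext s
    have : e' s ∈ A ⊓ Y := ⟨h1 ⟨s, rfl⟩, h2 ⟨s, rfl⟩⟩
    rw [hY.inf_eq_bot, Submodule.mem_bot] at this
    rw [this, LinearMap.zero_apply]
  set E : Submodule R M := LinearMap.range (e p) with hE
  have hEle : E ≤ gr p := by rintro _ ⟨s, rfl⟩; exact he p s
  have htop : (⊤ : Submodule R M) = G' ⊔ gr p := by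
    rw [← hsup, iSup_split_single gr p, sup_comm]
  -- images under a degree `c` map `T`: disjointness by degree
  have hdeg_disj : ∀ T : M →ₗ[R] M, (∀ k, ∀ x ∈ gr k, T x ∈ gr (k + c)) →
      Disjoint (G'.map T) ((gr p).map T) := by
    intro T hT
    have h1 : G'.map T ≤ ⨆ (i) (_ : i ≠ p + c), gr i := by
      rw [Submodule.map_le_iff_le_comap]
      refine iSup_le fun i => iSup_le fun hi => fun x hx => ?_
      exact hmem_ne (show i + c ≠ p + c by omega) (hT i x hx)
    have h2 : (gr p).map T ≤ gr (p + c) := by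
      rintro _ ⟨x, hx, rfl⟩; exact hT p x hx
    exact (hind (p + c)).symm.mono h1 h2
  have hpow_deg : ∀ (T : M →ₗ[R] M), (∀ k, ∀ x ∈ gr k, T x ∈ gr (k + 1)) →
      ∀ k, ∀ x ∈ gr k, (T ^ c) x ∈ gr (k + c) := fun T hT k x hx =>
    Literature.RepresentationTheory.Semisimple.pow_apply_mem_gr gr T hT hx c
  -- ranges of restrictions
  have hrange_sub : ∀ (T : M →ₗ[R] M) (N : Submodule R M),
      LinearMap.range (T ∘ₗ N.subtype) = N.map T := fun T N => by
    rw [LinearMap.range_comp, Submodule.range_subtype]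
  -- upper bound for `rank (t ^ c)`
  have hupper : finrank K (LinearMap.range (t ^ c)) ≤
      finrank K (G'.map (t ^ c)) + finrank K (B.map (t ^ c)) := by
    have h1 : LinearMap.range (t ^ c) = G'.map (t ^ c) ⊔ B.map (t ^ c) := by
      have hA0 : A.map (t ^ c) = ⊥ := by
        rw [eq_bot_iff]
        rintro _ ⟨x, hx, rfl⟩
        rw [hAkill x hx]; exact zero_mem _
      rw [LinearMap.range_eq_map, htop, Submodule.map_sup, hgrp, Submodule.map_sup, hA0,
        bot_sup_eq]
    rw [h1]
    exact finrank_sup_le_R _ _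
  -- the three semicontinuity statements
  have hfin1 := finite_setOf_finrank_range_pow_lt (K := K) t u c G' 0
  have hfin2 := finite_setOf_finrank_range_pow_lt (K := K) t u c B 0
  have hfin3 := finite_setOf_finrank_range_pow_lt (K := K) u t c E 0
  rw [zero_smul, add_zero, hrange_sub] at hfin1
  rw [zero_smul, add_zero, hrange_sub] at hfin2
  rw [zero_smul, add_zero, hrange_sub] at hfin3
  set bad3 : Set K := {0} ∪ (fun x : K => x⁻¹) ''
    {s : K | finrank K (LinearMap.range (((u + s • t) ^ c) ∘ₗ E.subtype)) <
      finrank K (E.map (u ^ c))} with hbad3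
  have hfin3' : bad3.Finite := (Set.finite_singleton 0).union (hfin3.image _)
  obtain ⟨s, hs⟩ := ((hfin1.union hfin2).union hfin3').infinite_compl.nonempty
  rw [Set.mem_compl_iff, Set.mem_union, Set.mem_union, not_or, not_or] at hs
  obtain ⟨⟨hs1, hs2⟩, hs3⟩ := hs
  rw [Set.mem_setOf_eq, not_lt, hrange_sub] at hs1 hs2
  have hs0 : s ≠ 0 := fun h => hs3 (Or.inl h)
  have hs3' : finrank K (E.map (u ^ c)) ≤ finrank K (E.map ((u + s⁻¹ • t) ^ c)) := by
    by_contra hlt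
    refine hs3 (Or.inr ⟨s⁻¹, ?_, inv_inv s⟩)
    rw [Set.mem_setOf_eq, hrange_sub]
    exact not_le.mp hlt
  -- the deformed operator and its pieces
  set T := t + s • u with hTdef
  have hTc : T ^ c = s ^ c • (u + s⁻¹ • t) ^ c := by
    rw [← smul_pow]
    congr 1
    rw [hTdef, smul_add, smul_smul, mul_inv_cancel₀ hs0, one_smul, add_comm]
  have hEmap : E.map (T ^ c) = E.map ((u + s⁻¹ • t) ^ c) := by
    rw [hTc, map_smul_of_ne_zero _ (pow_ne_zero _ hs0)]
  have hE1 : 1 ≤ finrank K (E.map (T ^ c)) := by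
    rw [hEmap]
    refine le_trans ?_ hs3'
    have hne : E.map (u ^ c) ≠ ⊥ := by
      rw [hE, ← LinearMap.range_comp, ne_eq, LinearMap.range_eq_bot]
      exact huc_ne
    haveI := Literature.RepresentationTheory.Semisimple.finite_of_submodule K (E.map (u ^ c))
    haveI : Nontrivial (E.map (u ^ c)) := Submodule.nontrivial_iff_ne_bot.mpr hne
    exact Module.finrank_pos
  -- `T ^ c ∘ e p ≠ 0`, so its image (simple) is disjoint from the `S`-free `T ^ c (B)`
  have hTEne : (T ^ c) ∘ₗ e p ≠ 0 := by
    intro h0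
    have : E.map (T ^ c) = ⊥ := by
      rw [hE, ← LinearMap.range_comp, h0, LinearMap.range_zero]
    rw [this, finrank_bot_R] at hE1
    exact absurd hE1 (by norm_num)
  have hdisjEB : Disjoint (E.map (T ^ c)) (B.map (T ^ c)) := by
    rw [Submodule.disjoint_def]
    intro x hx hx'
    rw [hE, ← LinearMap.range_comp] at hx
    obtain ⟨s₀, rfl⟩ := hx
    set N' : Submodule R S := (B.map (T ^ c)).comap ((T ^ c) ∘ₗ e p) with hN'
    rcases eq_bot_or_eq_top N' with h | h
    · have : s₀ ∈ N' := hx'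
      rw [h, Submodule.mem_bot] at this
      rw [this, map_zero]
    · exfalso
      apply hTEne
      exact eq_zero_of_forall_mem_map B hBfree (T ^ c) _ fun s₁ => (h ▸ Submodule.mem_top : s₁ ∈ N')
  -- lower bound for `rank (T ^ c)`
  have hTcdeg := hpow_deg T (hTdeg s)
  have hlower : finrank K (G'.map (T ^ c)) + finrank K (B.map (T ^ c)) + finrank K (E.map (T ^ c)) ≤
      finrank K (LinearMap.range (T ^ c)) := by
    have h1 : Disjoint (G'.map (T ^ c)) (B.map (T ^ c) ⊔ E.map (T ^ c)) :=
      (hdeg_disj (T ^ c) hTcdeg).mono_right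
        (sup_le (Submodule.map_mono hBle) (Submodule.map_mono hEle))
    rw [add_assoc, ← finrank_sup_eq_of_disjoint_R hdisjEB.symm, ← finrank_sup_eq_of_disjoint_R h1]
    refine finrank_le_of_le_R ?_
    rw [LinearMap.range_eq_map]
    exact sup_le (Submodule.map_mono le_top)
      (sup_le (Submodule.map_mono le_top) (Submodule.map_mono le_top))
  -- rank-maximality
  have hmaxT := hmax T (hTdeg s) c hc1
  omega

end RankMax

end RankLadderJ

end Summit.Langlands.Langlands.Theorems
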